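import Literature.AnabelianGeometry.SemiGraphs.TemperedAnchoredCompactOfTopCyclic
import HarnessLib

/-!
# The EXACT failure locus of the per-graph [SemiAnbd] Thm 3.7 (iii) and (iv) for topologically cyclic edge
# groups: nontrivial ANCHOR-FREE compact (resp. maximal compact) subgroups (proof-only)

Mochizuki, *Semi-graphs of anabelioids*, Publ. RIMS **42** (2006), §3, Theorem 3.7 (iii) pp. 40–41, (iv) p. 41
[cite: MochizukiSemiAnbd2006, Thm 3.7(iii) pp.40-41].

PROOF-ONLY file (abc-iut cell, layer L3, row «ANCHORED@STAR» sequel, seat abc-iut-w6-d064 gen 7; no definition, no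
named fact).  For a countable `𝒢` satisfying the hypotheses of Thm 3.7 whose EDGE GROUPS ARE TOPOLOGICALLY CYCLIC
(no condition on `𝔾`), the cell's per-graph typings `CompactInVerticialAt 𝒢` (Thm 3.7 (iii) AT `𝒢`, F-1732 family)
and `MaximalCompactIffVerticialAt 𝒢` (Thm 3.7 (iv) AT `𝒢`, F-1750 family) are each EQUIVALENT to the absence of
one kind of object (this seat's `TemperedAnchoredCompactOfTopCyclic.lean` + abc-iut-f-172's iff-form of sentences
2–3 on the class):

* `compactInVerticialAt_iff_forall_anchorFree_eq_bot_of_topCyclic` — **Thm 3.7 (iii) holds AT `𝒢` iff NO chart of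
  `𝒢` carries a NON-TRIVIAL compact subgroup meeting every verticial subgroup trivially** (such subgroups are
  levelwise cyclic, `TemperedExoticCompactLevelwiseEdgeLike.lean`);
* `maximalCompactIffVerticialAt_iff_forall_maximalCompact_not_anchorFree_of_topCyclic` — **Thm 3.7 (iv) holds AT
  `𝒢` iff NO chart carries a NON-TRIVIAL MAXIMAL compact subgroup meeting every verticial subgroup trivially**
  (both sentences of (iv) then follow from the anchored package; conversely such a subgroup is not verticial).

So at `𝒢_θ(p, n)` (abc-iut-L3-d1/d4, w6-d063) and `𝒢⋆(p)` (abc-iut-L3-t8) the typings fail for ONE reason only —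
escaping procyclic subgroups — and at every graph of the class without them both hold.  `nonempty_verticialSubgroups`
(Thm 3.7 (i) at every chart) is recorded on the way.  Nothing bears on [IUTchIII] Cor. 3.12; typed ≠ proved.
-/

namespace Literature.AnabelianGeometry.SemiGraphs

namespace ProfiniteSemiGraph

open Topology

universe u

variable {𝒢 : ProfiniteSemiGraph.{u}}

/-- **Verticial subgroups exist at every vertex, in every chart** ([SemiAnbd] Thm 3.7 (i): the decomposition
homomorphism of a compatible point sequence over `v` at the canonical chart — abc-iut-L3-t6's
`range_decompHom_mem_verticialSubgroups` — transported along `TemperedPiChart.exists_compatIso`).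
[cite: MochizukiSemiAnbd2006, Thm 3.7(i) p.40] -/
theorem nonempty_verticialSubgroups (h36 : 𝒢.Prop36Hypotheses) (c : TemperedPiChart 𝒢) (v : 𝒢.graph.Vertex) :
    (verticialSubgroups c v).Nonempty := by
  obtain ⟨φ, ψ, hψφ, hφψ, hφ, hψ⟩ := TemperedPiChart.exists_compatIso (𝒢.temperedPiChart h36) c
  obtain ⟨P⟩ := GaloisLevelData.nonempty_pointSeq h36 v
  exact ⟨_, mem_verticialSubgroups_map φ hφ P.range_decompHom_mem_verticialSubgroups⟩

variable (𝒢)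

/-- **Thm 3.7 (iii) AT `𝒢` ⟺ no nontrivial ANCHOR-FREE compact subgroup** (topologically cyclic edge groups, any
`𝔾`): `CompactInVerticialAt 𝒢` holds iff, under the hypotheses of Thm 3.7, every compact subgroup (of any chart)
meeting every verticial subgroup trivially is trivial.  («⇒»: a compact `K` lies in some verticial `H`, so
`K = K ⊓ H = 1`; «⇐»: sentences 2–3 hold on the class (abc-iut-f-172's `compactInVerticialAt_iff_exists_verticial_of_topCyclic`),
and a compact `K` is either `1` — inside any verticial subgroup, which exist (`nonempty_verticialSubgroups`) — or
not anchor-free, i.e. anchored, hence verticial-contained (`exists_verticial_ge_of_inf_verticial_ne_bot_of_topCyclic`).)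
[cite: MochizukiSemiAnbd2006, Thm 3.7(iii) pp.40-41] -/
theorem compactInVerticialAt_iff_forall_anchorFree_eq_bot_of_topCyclic
    (hcyc : ∀ e : 𝒢.graph.Edge, ∃ t₀ : 𝒢.Ge e, (Subgroup.zpowers t₀).topologicalClosure = ⊤) :
    CompactInVerticialAt 𝒢 ↔
      (𝒢.Thm37Hypotheses → ∀ (c : TemperedPiChart 𝒢) (K : Subgroup c.G), IsCompact (K : Set c.G) →
        (∀ (v : 𝒢.graph.Vertex) (H : Subgroup c.G), H ∈ verticialSubgroups c v → K ⊓ H = ⊥) → K = ⊥) := by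
  constructor
  · intro hCIV h37 c K hKc hfree
    obtain ⟨v, H, hH, hKH⟩ := (hCIV h37 c K hKc).1
    rw [← inf_eq_left.mpr hKH]
    exact hfree v H hH
  · intro h
    rw [𝒢.compactInVerticialAt_iff_exists_verticial_of_topCyclic hcyc]
    intro h37 c K hKc
    obtain ⟨v₀⟩ := h37.hasVertex
    obtain ⟨H₀, hH₀⟩ := nonempty_verticialSubgroups h37.toProp36Hypotheses c v₀
    by_cases hfree : ∀ (v : 𝒢.graph.Vertex) (H : Subgroup c.G), H ∈ verticialSubgroups c v → K ⊓ H = ⊥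
    · exact ⟨v₀, H₀, hH₀, (h h37 c K hKc hfree).symm ▸ bot_le⟩
    · push Not at hfree
      obtain ⟨v₁, H₁, hH₁, hanch⟩ := hfree
      exact exists_verticial_ge_of_inf_verticial_ne_bot_of_topCyclic h37 hcyc c K hKc hH₁ hanch

/-- **Thm 3.7 (iv) AT `𝒢` ⟺ no nontrivial ANCHOR-FREE MAXIMAL compact subgroup** (topologically cyclic edge groups,
any `𝔾`): `MaximalCompactIffVerticialAt 𝒢` holds iff, under the hypotheses of Thm 3.7, every non-trivial maximal
compact subgroup (of any chart) meets SOME verticial subgroup non-trivially.  («⇒»: a maximal compact `K ≠ 1` is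
verticial, and `K ⊓ K = K`; «⇐»: first sentence — a maximal compact `K` is verticial: if `K = 1`, every verticial
subgroup (compact, `⊇ 1`) equals `1 = K`; if `K ≠ 1` it is anchored, `exists_mem_verticialSubgroups_of_isMaximalCompactSubgroup_of_topCyclic`;
verticial ⇒ maximal compact is `isMaximalCompactSubgroup_of_mem_verticialSubgroups_of_topCyclic`; second sentence —
`exists_maximalCompact_inf_eq_of_mem_edgeLikeSubgroups_of_topCyclic` and, for `K₁ ⊓ K₂ ≠ 1` (so `K₁ ≠ 1` is
anchored), `exists_mem_edgeLikeSubgroups_of_maximalCompact_inf_of_anchored_of_topCyclic`.)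
[cite: MochizukiSemiAnbd2006, Thm 3.7(iv) p.41] -/
theorem maximalCompactIffVerticialAt_iff_forall_maximalCompact_not_anchorFree_of_topCyclic
    (hcyc : ∀ e : 𝒢.graph.Edge, ∃ t₀ : 𝒢.Ge e, (Subgroup.zpowers t₀).topologicalClosure = ⊤) :
    MaximalCompactIffVerticialAt 𝒢 ↔
      (𝒢.Thm37Hypotheses → ∀ (c : TemperedPiChart 𝒢) (K : Subgroup c.G), IsMaximalCompactSubgroup K → K ≠ ⊥ →
        ∃ (v : 𝒢.graph.Vertex) (H : Subgroup c.G), H ∈ verticialSubgroups c v ∧ K ⊓ H ≠ ⊥) := by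
  constructor
  · intro hIV h37 c K hK hKne
    obtain ⟨v, hKv⟩ := ((hIV h37 c).1 K).mp hK
    exact ⟨v, K, hKv, by rwa [inf_idem]⟩
  · intro h h37 c
    -- first sentence: maximal compact ⇔ verticial
    have hfirst : ∀ K : Subgroup c.G, IsMaximalCompactSubgroup K ↔ ∃ v, K ∈ verticialSubgroups c v := by
      intro K
      refine ⟨fun hK => ?_, fun ⟨v, hK⟩ => 𝒢.isMaximalCompactSubgroup_of_mem_verticialSubgroups_of_topCyclic h37 hcyc c hK⟩
      by_cases hKbot : K = ⊥
      · obtain ⟨v₀⟩ := h37.hasVertex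
        obtain ⟨H₀, hH₀⟩ := nonempty_verticialSubgroups h37.toProp36Hypotheses c v₀
        have hH₀K : H₀ = K := hK.2 H₀ (isCompact_of_mem_verticialSubgroups c hH₀) (hKbot ▸ bot_le)
        exact ⟨v₀, hH₀K ▸ hH₀⟩
      · obtain ⟨v, H, hH, hanch⟩ := h h37 c K hK hKbot
        exact exists_mem_verticialSubgroups_of_isMaximalCompactSubgroup_of_topCyclic h37 hcyc c K hK hH hanch
    refine ⟨hfirst, fun L hL => ⟨?_, ?_⟩⟩
    · rintro ⟨K₁, K₂, hK₁, hK₂, hne, rfl⟩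
      have hK₁ne : K₁ ≠ ⊥ := fun h0 => hL (by rw [h0, bot_inf_eq])
      obtain ⟨v, H, hH, hanch⟩ := h h37 c K₁ hK₁ hK₁ne
      exact 𝒢.exists_mem_edgeLikeSubgroups_of_maximalCompact_inf_of_anchored_of_topCyclic h37 hcyc c hK₁ hK₂ hne
        hL hH hanch
    · rintro ⟨e, he, hLe⟩
      exact 𝒢.exists_maximalCompact_inf_eq_of_mem_edgeLikeSubgroups_of_topCyclic h37 hcyc c he hLe hL

/-- **Thm 3.7 (iii) AT `𝒢` ⟹ Thm 3.7 (iv) AT `𝒢` on the class, through the failure loci**: no nontrivial anchor-free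
compact subgroup ⇒ no nontrivial anchor-free maximal compact subgroup.  (The converse is NOT claimed: an
anchor-free compact subgroup need not lie in a maximal compact one.) [cite: MochizukiSemiAnbd2006, Thm 3.7(iv) p.41] -/
theorem maximalCompactIffVerticialAt_of_compactInVerticialAt_of_topCyclic
    (hcyc : ∀ e : 𝒢.graph.Edge, ∃ t₀ : 𝒢.Ge e, (Subgroup.zpowers t₀).topologicalClosure = ⊤)
    (hCIV : CompactInVerticialAt 𝒢) : MaximalCompactIffVerticialAt 𝒢 := by
  rw [𝒢.maximalCompactIffVerticialAt_iff_forall_maximalCompact_not_anchorFree_of_topCyclic hcyc]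
  intro h37 c K hK hKne
  by_contra hno
  push Not at hno
  exact hKne ((𝒢.compactInVerticialAt_iff_forall_anchorFree_eq_bot_of_topCyclic hcyc).mp hCIV h37 c K hK.1 hno)

end ProfiniteSemiGraph

end Literature.AnabelianGeometry.SemiGraphs
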